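/-
Copyright (c) 2026 the pub-hodgecm-mathlib formalisation cell (harness21).  Prover seat hodgecm-mathlib-R90-IF-p06 (g2), S9 «InnerForm-13.3.6 (c)»,
hand (o-B) «A2 WITNESS PINS» (S9 dealer R90-IF-plan (g2) DEALS 2026-09-05T03:01:28Z (2); HEADS 03:04:08Z): the S2-payable letters `hp ha₀ ha₂ hane`
of the producer's A2 «two-member arch» group, DISCHARGED at the pins of record `p a₀ a₂` BY NAME from ★ S2 CARD 10 (p864843), ★ `R90S2JInfNeDsInfOfRecord`
and ★ pin #18 `R90S2ArchPacketPinOfRecord`.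
-/
import Summits.HodgeConjecture.HodgeConjecture.Theorems.R90S2CarriersOfRecordAdmissibleUnitary   -- ★ p864843 (S2 CARD 10): `R90.S2.jInfOfRecord_mem_support`, `R90.S2.dsInfOfRecord_mem_support` (+ ★ #23 `K2E1bCarriersOfRecord`: `jInfOfRecord`, `dsInfOfRecord`)
import Summits.HodgeConjecture.HodgeConjecture.Theorems.R90S2JInfNeDsInfOfRecord               -- ★ (S2): `R90.S2.jInfOfRecord_ne_dsInfOfRecord` (§12.3: `πⁿ(ξ_∞) ≠ πˢ(ξ_∞)`)
import Summits.HodgeConjecture.HodgeConjecture.Theorems.R90S2ArchPacketPinOfRecord              -- ★ (S2 pin #18): `R90.S2.archPacketAt_πn_eq_jInfOfRecord` (+ ★ K6 `F0P3XiArchPacketOfRecord`: `archPacketOfRecord`, `archPacketOfRecord_πn_of_not`, `archPacketOfRecord_πs`)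
import HarnessLib

/-!
# R90-TF · S9 «InnerForm-13.3.6 (c)» — (o-B) THE A2 WITNESS PINS OF RECORD: the producer letters `hp ha₀ ha₂ hane` DISCHARGED at
# `p := «non-split»`, `a₀ := πⁿ(ξ_ι)`, `a₂ := πˢ(ξ_ι)` of the archimedean A-packet of record `Π(ξ_ι) = {πⁿ(ξ_ι), πˢ(ξ_ι)}`

Cell `pub/hodgecm-mathlib` (D-0151), crux H413 = `stmt-HodgeConjecture-24833` (`--supports … --as helper`; closes nothing by itself).

WHAT.  S9 FILE B ED. 4 (v0.1, typist R90-IF-typ2 (g2), cand sha16 9c821f62) carries ONE ∃-producer `sock_S9_recordDatumLaws_cm` whose LAST named group is the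
A2 «two-member arch» group of the ★ pay line `R90.S9.definiteAeRigidity_payLine_stableA2'` (★ p864612, M3): ∃-DATA
`p : ∀ ξ : X.G.PacketH, X.IsOneDimH ξ → HeightOneSpectrum (𝓞 L⁺) → Prop`, `a₀ a₂ : ∀ ξ, X.IsOneDimH ξ → GKIrrClass (uFormGroup (Fin 2) (Fin 1))`,
`cpt : ∀ ξ, X.IsOneDimH ξ → Prop`, and LAWS `hp ha₀ ha₂ hane hR₁ hR₂ hR₀G hR₀H`.  The INTENDED PINS (producer docstring (1)–(4); R90-IF-p07 (g2) `A2-STATEMENTS`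
B-PINS; S9 dealer 03:01:28Z «S2 dictionary») are, with `ξ₁ := X.oneDimOf ξ h₁ : OneDimAutRepH L`, `p := ξ₁.pη ι`, `q := ξ₁.qψ ι`,
`t := ArchSignRecipe.tOfArchType (archTypeOfRecord μω) ι` (print's three integers of `ξ_ι` and `μ_ι`, [Rogawski1990, §12.3 p. 174, p. 178]):
* `p    := fun ξ h₁ v => ∀ w : PlacesOver L v, c̄ • w.1 = w.1` — the NON-SPLIT finite places of `L⁺` in `L`;
* `a₀   := fun ξ h₁ => (archPacketOfRecord ι μω jInfOfRecord dsInfOfRecord ξ₁).πn` (B-PIN) `= jInfOfRecord p q t` (S2 reading; the two agree, §0) — `πⁿ(ξ_ι) = J^±_φ`;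
* `a₂   := fun ξ h₁ => dsInfOfRecord p q t` — `πˢ(ξ_ι) = D^∓_φ ∕ π²_φ`, the `πs` member (`(archPacketOfRecord …).πs = some (dsInfOfRecord p q t)`, ★ `archPacketOfRecord_πs`, `rfl`);
* `cpt  := fun ξ h₁ => cptXi₀ ι μω ξ₁` — DATA read only by `hR₁ hR₂ hR₀G hR₀H` (payers S5∕S8∕S2, junction JQ-S7-13); no S9-dischargeable law, NOT in this file.
THIS FILE discharges, X-free and kit-free, the four S2-payable laws AT THOSE PINS, each as a named theorem whose conclusion is the producer letter's TYPE
VERBATIM with the pin substituted (so FILE B ED. 5 closes the conjunct by `exact R90.S9.a2Pin_… ι μω X.IsOneDimH X.oneDimOf` — explicit arguments in the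
section's order `ι μω IsOneDimH oneDimOf`, `a2Pin_hp` taking `IsOneDimH` only — β-reduction only):
* §0 `archPacketOfRecord_πn_eq_jInfOfRecord` — over the carriers of record `πⁿ` of the packet of record IS `jInfOfRecord p q t`, on AND off the cohomological locus
  (on it: ★ S2 pin #18 `archPacketAt_πn_eq_jInfOfRecord` — the kit's named class `[J^{rogSign p t}]` is the `J`-carrier of record; off it: ★ `archPacketOfRecord_πn_of_not`,
  definitional).  This is the Theorems-side twin of `archPacketOfRecord_πn_ofRecord` of the S7 LINES file `Cruxes/H413/Lines/R90_S7_ArchMemberIotaJunctionE.lean` :128,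
  which a `Theorems/` module may not import (CONVENTIONS §2); same proof, stated here so that both pin readings are served by name.
* §1 `a2Pin_hp` (letter `hp`: the place predicate implies non-split — at the pin it IS non-split, `fun _ _ _ h => h`), `a2Pin_ha₀` ∕ `a2Pin_ha₀_carrier` (letter `ha₀`
  at the B-PIN ∕ at the S2 reading: `πⁿ(ξ_ι)` lies in the support class of ★ `globalCharactersLinIndep` — admissible `ρK`, infinitesimally unitary along `𝔭 ⊕ ℝz₀` — BY NAME
  ★ CARD 10 `R90.S2.jInfOfRecord_mem_support`), `a2Pin_ha₂` (letter `ha₂`: the same for `πˢ(ξ_ι)`, ★ `R90.S2.dsInfOfRecord_mem_support`), `a2Pin_hane` ∕ `a2Pin_hane_carrier`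
  (letter `hane : a₂ ξ h₁ ≠ a₀ ξ h₁`: the two archimedean members are distinct classes, ★ `R90.S2.jInfOfRecord_ne_dsInfOfRecord` — [Rogawski1990, §12.3 Prop. 12.3.3 p. 178]:
  `Π(ξ_ι)` has TWO members at a real place where `G′ = U(2,1)`).
GENERIC CARRIER.  The letters are typed over the datum's `H`-packet carrier; here `{PH : Sort*} (IsOneDimH : PH → Prop) (oneDimOf : ∀ ρ : PH, IsOneDimH ρ → OneDimAutRepH L)`
stand for `X.G.PacketH`, `X.IsOneDimH`, `X.oneDimOf` of `X := X_cm …` (★ `R90S9DatumOfRecordCM`) — or of any datum: nothing here reads `X`.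
THEOREMS ONLY (no definition ∕ instance ∕ notation ∕ named fact ∕ `sorry`); imports ★ `Theorems` only; axioms TRIO.  HONEST LABEL: by-name repackaging of ★ S2 facts
(CARD 10, pin #18, `jInf ≠ dsInf`) at the S9 pins — pays no NEW printed input and no S9 socket until an edition of FILE B consumes it; HC_CM is proved only modulo the
7 printed citations (2 remaining named inputs: hLiu418 = stmt-HodgeConjecture-24832, h413 = stmt-HodgeConjecture-24833) until rung 0 closes; count-neutral.

## References
* [Rogawski1990] J. Rogawski, *Automorphic Representations of Unitary Groups in Three Variables*, Annals of Math. Studies 123 (1990), §12.3 pp. 174–178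
  (Prop. 12.3.3: the archimedean packets `Π(ξ_ι) = {πⁿ(ξ_ι), πˢ(ξ_ι)}`), §13.1 p. 199, §14.6 p. 244 (the two archimedean members in (14.6.2)–(14.6.3)).
* [BorelWallach2000] A. Borel, N. Wallach, *Continuous Cohomology, Discrete Subgroups, and Representations of Reductive Groups*, 2nd ed. (2000), 0 §2.5, VI Thm. 4.11–4.12.
* [Kovacevic2021] D. Kovačević, *Classification of irreducible unitary `(𝔤,K)`-modules of `SU(2,1)` via `K`-types* (2021), §4 Thms. 4–5 (the carriers of record).
-/

set_option autoImplicit false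
-- the mandated namespace repeats `HodgeConjecture.HodgeConjecture`, as in every `Theorems/*.lean` of this sub-problem
set_option linter.dupNamespace false

noncomputable section

open NumberField IsDedekindDomain
open Literature.RepresentationTheory Literature.NumberTheory.Automorphic Literature.NumberTheory.Automorphic.UnitaryGroup
open Literature.NumberTheory.GaloisRepresentations Literature.NumberTheory.Rogawski1990
open Literature.RepresentationTheory.KonnoKonno2007

namespace Summit.HodgeConjecture.HodgeConjecture.R90.S9

open Summit.HodgeConjecture.HodgeConjecture.Cruxes.H413
open Summit.HodgeConjecture.HodgeConjecture.Cruxes.H413.F0P3XiArchDataOfRecord (archTypeOfRecord)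
open Summit.HodgeConjecture.HodgeConjecture.Cruxes.H413.F0P3XiArchPacketOfRecord (archPacketOfRecord archPacketOfRecord_def archPacketOfRecord_πn_of_not
  archPacketOfRecord_πs)
open Summit.HodgeConjecture.HodgeConjecture.Cruxes.H413.K2E1bCarriersOfRecord (jInfOfRecord dsInfOfRecord)

variable {L : Type} [Field L] [NumberField L] [IsCMField L] (ι : L →+* ℂ) (μω : HeckeCharacter L)

/-! ## §0 Over the carriers of record, `πⁿ(ξ_ι)` of the packet of record IS `jInfOfRecord p q t` — the B-PIN and the S2 reading of `a₀` agree -/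

/-- **`πⁿ` of the archimedean packet of record over the CARRIERS OF RECORD is the `J`-carrier class of record, on and off the cohomological locus**:
`(archPacketOfRecord ι μω jInfOfRecord dsInfOfRecord ξ₁).πn = jInfOfRecord (ξ₁.pη ι) (ξ₁.qψ ι) t`, `t = tOfArchType k₀ ι`.  On the locus `πⁿ` is the kit's
NAMED class `[J^{rogSign p t}]`, identified with `jInfOfRecord p q t` by ★ S2 pin #18 `archPacketAt_πn_eq_jInfOfRecord`; off it the equation is ★
`archPacketOfRecord_πn_of_not` (definitional).  Theorems-side twin of the S7 Lines lemma `archPacketOfRecord_πn_ofRecord` (not importable here).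
[cite: Rogawski1990, §12.3 Prop. 12.3.3 p. 178] -/
theorem archPacketOfRecord_πn_eq_jInfOfRecord (ξ₁ : OneDimAutRepH L) :
    (archPacketOfRecord ι μω jInfOfRecord dsInfOfRecord ξ₁).πn =
      jInfOfRecord (ξ₁.pη ι) (ξ₁.qψ ι) (ArchSignRecipe.tOfArchType (archTypeOfRecord μω) ι) := by
  by_cases h : ξ₁.IsCohTrivialAt (ArchSignRecipe.tOfArchType (archTypeOfRecord μω) ι) ι
  · rw [archPacketOfRecord_def]
    unfold OneDimAutRepH.IsCohTrivialAt at h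
    exact R90.S2.archPacketAt_πn_eq_jInfOfRecord h
  · exact archPacketOfRecord_πn_of_not jInfOfRecord dsInfOfRecord ι μω ξ₁ h

/-- **The `πs` slot of the packet of record over the carriers of record is `some (dsInfOfRecord p q t)`** — the pin `a₂` IS the second member (never `none` at a
real place where `G′ = U(2,1)`; ★ `archPacketOfRecord_πs`, `rfl`). [cite: Rogawski1990, §12.3 Prop. 12.3.3 p. 178; §14.6 p. 244] -/
theorem archPacketOfRecord_πs_eq_dsInfOfRecord (ξ₁ : OneDimAutRepH L) :
    (archPacketOfRecord ι μω jInfOfRecord dsInfOfRecord ξ₁).πs =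
      some (dsInfOfRecord (ξ₁.pη ι) (ξ₁.qψ ι) (ArchSignRecipe.tOfArchType (archTypeOfRecord μω) ι)) :=
  archPacketOfRecord_πs jInfOfRecord dsInfOfRecord ι μω ξ₁

/-! ## §1 The four S2-payable A2 laws AT THE PINS, over a generic `H`-packet carrier `(PH, IsOneDimH, oneDimOf)` -/

section Pins

universe u

variable {PH : Sort u} (IsOneDimH : PH → Prop) (oneDimOf : ∀ ρ : PH, IsOneDimH ρ → OneDimAutRepH L)

/-- **Letter `hp` AT THE PIN `p := fun ξ h₁ v => ∀ w : PlacesOver L v, c̄ • w.1 = w.1`** («the place predicate implies non-split»): at the pin the predicate IS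
«`v` non-split in `L/L⁺`», so the law is the identity implication.  The type is the producer's `hp` conjunct VERBATIM with `p ξ h₁ v` unfolded.
[cite: Rogawski1990, §12.2 p. 173; §14.6 p. 244] -/
theorem a2Pin_hp :
    ∀ (ξ : PH) (_h₁ : IsOneDimH ξ) (v : HeightOneSpectrum (𝓞 ↥(maximalRealSubfield L))),
      (∀ w : PlacesOver L v, IsCMField.complexConj L • w.1 = w.1) → ∀ w : PlacesOver L v, IsCMField.complexConj L • w.1 = w.1 :=
  fun _ _ _ h => h

/-- **Letter `ha₀` AT THE B-PIN `a₀ := fun ξ h₁ => (archPacketOfRecord ι μω jInfOfRecord dsInfOfRecord (oneDimOf ξ h₁)).πn`**: the non-tempered archimedean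
member `πⁿ(ξ_ι)` lies in the support class of ★ `globalCharactersLinIndep` — `∃ r, GKIrrClass.mk r = a₀ ξ h₁ ∧ IsAdmissibleGK r.ρK ∧ r.IsInfUnitaryAlongP` (support
conjunct VERBATIM).  By §0 and ★ S2 CARD 10 `jInfOfRecord_mem_support` (witness: the bundled `J`-carrier of record ★ `jRepOfRecord p q t`).
[cite: Rogawski1990, §12.3 Prop. 12.3.3 p. 178] [cite: BorelWallach2000, 0 §2.5, VI Thm. 4.12 (2)] [cite: Kovacevic2021, §4 Thm. 4–5] -/
theorem a2Pin_ha₀ :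
    ∀ (ξ : PH) (h₁ : IsOneDimH ξ), ∃ r : GKIrrep (uFormGroup (Fin 2) (Fin 1)),
      GKIrrClass.mk r = (archPacketOfRecord ι μω jInfOfRecord dsInfOfRecord (oneDimOf ξ h₁)).πn ∧ IsAdmissibleGK r.ρK ∧ r.IsInfUnitaryAlongP := by
  intro ξ h₁
  rw [archPacketOfRecord_πn_eq_jInfOfRecord]
  exact R90.S2.jInfOfRecord_mem_support _ _ _

/-- **Letter `ha₀` AT THE S2 READING `a₀ := fun ξ h₁ => jInfOfRecord p q t`** (`p = (oneDimOf ξ h₁).pη ι`, `q = (oneDimOf ξ h₁).qψ ι`, `t = tOfArchType k₀ ι`):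
★ CARD 10 `jInfOfRecord_mem_support` re-keyed by `(ξ, h₁)`. [cite: Rogawski1990, §12.3 Prop. 12.3.3 p. 178] [cite: BorelWallach2000, VI Thm. 4.12 (2)] -/
theorem a2Pin_ha₀_carrier :
    ∀ (ξ : PH) (h₁ : IsOneDimH ξ), ∃ r : GKIrrep (uFormGroup (Fin 2) (Fin 1)),
      GKIrrClass.mk r = jInfOfRecord ((oneDimOf ξ h₁).pη ι) ((oneDimOf ξ h₁).qψ ι) (ArchSignRecipe.tOfArchType (archTypeOfRecord μω) ι) ∧
        IsAdmissibleGK r.ρK ∧ r.IsInfUnitaryAlongP :=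
  fun _ _ => R90.S2.jInfOfRecord_mem_support _ _ _

/-- **Letter `ha₂` AT THE PIN `a₂ := fun ξ h₁ => dsInfOfRecord p q t`**: the square-integrable archimedean member `πˢ(ξ_ι)` lies in the support class of ★
`globalCharactersLinIndep` (support conjunct VERBATIM) — ★ S2 CARD 10 `dsInfOfRecord_mem_support` re-keyed by `(ξ, h₁)` (witness ★ `dsRepOfRecord p q t`).
[cite: Rogawski1990, §12.3 Prop. 12.3.3 pp. 177–178] [cite: BorelWallach2000, 0 §2.5, VI Thm. 4.12 (2)] [cite: Kovacevic2021, §4 Thm. 4–5] -/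
theorem a2Pin_ha₂ :
    ∀ (ξ : PH) (h₁ : IsOneDimH ξ), ∃ r : GKIrrep (uFormGroup (Fin 2) (Fin 1)),
      GKIrrClass.mk r = dsInfOfRecord ((oneDimOf ξ h₁).pη ι) ((oneDimOf ξ h₁).qψ ι) (ArchSignRecipe.tOfArchType (archTypeOfRecord μω) ι) ∧
        IsAdmissibleGK r.ρK ∧ r.IsInfUnitaryAlongP :=
  fun _ _ => R90.S2.dsInfOfRecord_mem_support _ _ _

/-- **Letter `hane : a₂ ξ h₁ ≠ a₀ ξ h₁` AT THE B-PINS** (`a₂ := dsInfOfRecord p q t`, `a₀ := (archPacketOfRecord ι μω jInfOfRecord dsInfOfRecord (oneDimOf ξ h₁)).πn`):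
the two archimedean members `πˢ(ξ_ι)`, `πⁿ(ξ_ι)` of `Π(ξ_ι)` are DISTINCT classes — by §0 and ★ S2 `jInfOfRecord_ne_dsInfOfRecord` (the `J`-ladder ray and the
square-integrable wall ray carry different `K`-types). [cite: Rogawski1990, §12.3 Prop. 12.3.3 p. 178] [cite: Kovacevic2021, §4 Thm. 4–5] -/
theorem a2Pin_hane :
    ∀ (ξ : PH) (h₁ : IsOneDimH ξ),
      dsInfOfRecord ((oneDimOf ξ h₁).pη ι) ((oneDimOf ξ h₁).qψ ι) (ArchSignRecipe.tOfArchType (archTypeOfRecord μω) ι) ≠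
        (archPacketOfRecord ι μω jInfOfRecord dsInfOfRecord (oneDimOf ξ h₁)).πn := by
  intro ξ h₁
  rw [archPacketOfRecord_πn_eq_jInfOfRecord]
  exact (R90.S2.jInfOfRecord_ne_dsInfOfRecord _ _ _).symm

/-- **Letter `hane` AT THE S2 READING** (`a₂ := dsInfOfRecord p q t`, `a₀ := jInfOfRecord p q t`): `dsInfOfRecord p q t ≠ jInfOfRecord p q t`, ★ S2
`jInfOfRecord_ne_dsInfOfRecord` `.symm`, re-keyed by `(ξ, h₁)`. [cite: Rogawski1990, §12.3 Prop. 12.3.3 p. 178] [cite: Kovacevic2021, §4 Thm. 4–5] -/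
theorem a2Pin_hane_carrier :
    ∀ (ξ : PH) (h₁ : IsOneDimH ξ),
      dsInfOfRecord ((oneDimOf ξ h₁).pη ι) ((oneDimOf ξ h₁).qψ ι) (ArchSignRecipe.tOfArchType (archTypeOfRecord μω) ι) ≠
        jInfOfRecord ((oneDimOf ξ h₁).pη ι) ((oneDimOf ξ h₁).qψ ι) (ArchSignRecipe.tOfArchType (archTypeOfRecord μω) ι) :=
  fun _ _ => (R90.S2.jInfOfRecord_ne_dsInfOfRecord _ _ _).symm

/-- **The pins are MEMBERS of the packet of record**: `a₀ ξ h₁ ∈ Π(ξ_ι).members` and `a₂ ξ h₁ ∈ Π(ξ_ι).members` (★ `LocalAPacket.members_of_πs_eq_some`) — the reading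
the ι-export ★ `R90.S9.archSlot_of_contribA_guarded` and the `hcoeffMem` rows use. [cite: Rogawski1990, §13.1 p. 199; §12.3 Prop. 12.3.3 p. 178] -/
theorem a2Pin_mem_members (ξ : PH) (h₁ : IsOneDimH ξ) :
    (archPacketOfRecord ι μω jInfOfRecord dsInfOfRecord (oneDimOf ξ h₁)).πn ∈ (archPacketOfRecord ι μω jInfOfRecord dsInfOfRecord (oneDimOf ξ h₁)).members ∧
      dsInfOfRecord ((oneDimOf ξ h₁).pη ι) ((oneDimOf ξ h₁).qψ ι) (ArchSignRecipe.tOfArchType (archTypeOfRecord μω) ι) ∈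
        (archPacketOfRecord ι μω jInfOfRecord dsInfOfRecord (oneDimOf ξ h₁)).members := by
  rw [LocalAPacket.members_of_πs_eq_some _ (archPacketOfRecord_πs_eq_dsInfOfRecord ι μω (oneDimOf ξ h₁))]
  exact ⟨Set.mem_insert _ _, Set.mem_insert_of_mem _ (Set.mem_singleton _)⟩

end Pins

end Summit.HodgeConjecture.HodgeConjecture.R90.S9

end
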